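import Summits.QuantumFields.YangMills.Theorems.PoincareLipschitzTwoSidedOfConcentrationBudget

/-!
# Crux `HistoryTailL` (stmt-QuantumFields-19936), line #12 — THE p-LINEAR GLUE (A′2): THE SCALAR BUDGET with a p-LINEAR induction hypothesis

Cell `ym3-torus` (YM ladder rung R3 = continuum SU(2) Yang–Mills on the 3-torus — NOT d = 4, NOT infinite volume, NOT a mass gap, NOT the Clay
problem), width seat `ym-ust-19936-w4` gen 12; `--supports stmt-QuantumFields-19936 --as helper`.  Companion of `…PoincareLipschitzLinearStep` (A′1)
and `…PoincareLipschitzHistoryTailOfLinearTail` (B′): in the height induction run with an EXPONENTIAL (Poincaré-class) concentration hypothesis,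
the finer averaged levels `1 ≤ i < j` carry tails `Cc·e^{−c₁·p(g_{K−i})}` (LINEAR in `p`); this file is ✓`localGood_budget` with that shape —
`γ ≤ γ_A` still makes the local bad set of a level-`j` plaquette rare (`≤ 1∕4`), uniformly in `K` and `j ≤ K`, PROVIDED `c₁·b₀ ≥ 8` (the polynomial
local volume `L^{3(j−i)} ≤ e^{6x}` is beaten by `e^{−c₁b₀x}`; the profile threshold `bmin` of the p-linear statements absorbs it).  The lemmas
`coupling_basic`, `pow_cube_le_exp`, `inv_coupling_sq_eq_exp`, `sq_log_le_pFun_sq`, `sum_Ico_inv_pow_le_one` of the landed budget are REUSED by import.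
Elementary real analysis; nothing of K1∕K2, the cruxes, rung R3 or the mass gap is proved.  THEOREMS ONLY, definition-free.
-/

set_option autoImplicit false

namespace Summit.QuantumFields.YangMills.Theorems.PoincareLipschitzLinear

open scoped BigOperators
open Literature.MathematicalPhysics.QuantumFieldTheory.Balaban1983to89
open Summit.QuantumFields.YangMills.Theorems.PoincareLipschitz.TwoSidedOfConcentration

/-- **THE SCALAR BUDGET OF THE HEIGHT INDUCTION, p-LINEAR INDUCTION HYPOTHESIS.**  For `L ≥ 2`, `b₀ > 0`, `p₀ ≥ 1`, constants
`V, C₀, Cc ≥ 0`, `c₀, c₁ > 0` and the threshold `8 ≤ c₁·b₀` there is `γ_A ∈ (0, 1]` such that for all `0 < γ ≤ γ_A`, all `K` and all `j ≤ K`: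
`V·L^{3j}·C₀·β_K⁵·e^{−c₀ p(g_K)²} + Σ_{1 ≤ i < j} V·L^{3(j−i)}·Cc·e^{−c₁ p(g_{K−i})} ≤ 1∕4` — ✓`localGood_budget` with the averaged-level terms in the
p-LINEAR shape (the finest-level term keeps the tree's Gaussian-in-`p` chessboard shape).  Mechanism for the linear terms: `p(g_h) ≥ b₀·x_h`,
`x_h = log g_h⁻¹ ≥ 0`, so `L^{3h}·e^{−c₁p} ≤ e^{6x_h − c₁b₀x_h} ≤ e^{−2x_h} = γL^{−h}` once `c₁b₀ ≥ 8`; then `Σ_h L^{−h} ≤ 1`.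
[adapted from ✓`PoincareLipschitzTwoSidedOfConcentrationBudget.localGood_budget`; folklore] -/
theorem localGood_budget_lin {L : ℕ} (hL : 2 ≤ L) {b₀ p₀ V C₀ c₀ Cc c₁ : ℝ} (hb₀ : 0 < b₀) (hp₀ : 1 ≤ p₀) (hV : 0 ≤ V)
    (hC₀ : 0 ≤ C₀) (hc₀ : 0 < c₀) (hCc : 0 ≤ Cc) (hc₁ : 0 < c₁) (hcb : 8 ≤ c₁ * b₀) :
    ∃ γA : ℝ, 0 < γA ∧ γA ≤ 1 ∧ ∀ γ : ℝ, 0 < γ → γ ≤ γA → ∀ K j : ℕ, j ≤ K →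
      V * ((L : ℝ) ^ j) ^ 3 * (C₀ * ((γ * ((L : ℝ)⁻¹) ^ K)⁻¹) ^ 5 *
          Real.exp (-(c₀ * B10.pFun b₀ p₀ (Real.sqrt (γ * ((L : ℝ)⁻¹) ^ K)) ^ 2))) +
        ∑ i ∈ Finset.Ico 1 j, V * ((L : ℝ) ^ (j - i)) ^ 3 *
          (Cc * Real.exp (-(c₁ * B10.pFun b₀ p₀ (Real.sqrt (γ * ((L : ℝ)⁻¹) ^ (K - i)))))) ≤ 1 / 4 := by
  have hL1 : 1 ≤ L := by omega
  have hL' : (1 : ℝ) ≤ L := by exact_mod_cast hL1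
  -- the quadratic rate of the finest level
  set c : ℝ := c₀ * b₀ ^ 2 with hc
  have hcpos : 0 < c := mul_pos hc₀ (pow_pos hb₀ 2)
  set X : ℝ := 18 / c + 1 with hX
  have hX0 : 0 ≤ X := by positivity
  -- the threshold
  set D : ℝ := V * (C₀ + Cc) + 1 with hD
  have hD0 : 0 < D := by positivity
  refine ⟨min 1 (min (Real.exp (-(2 * X))) (1 / (4 * D))), by positivity,
    min_le_left _ _, fun γ hγ hγA K j hjK => ?_⟩
  have hγ1 : γ ≤ 1 := hγA.trans (min_le_left _ _)
  have hγX : γ ≤ Real.exp (-(2 * X)) := hγA.trans ((min_le_right _ _).trans (min_le_left _ _))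
  have hγD : γ ≤ 1 / (4 * D) := hγA.trans ((min_le_right _ _).trans (min_le_right _ _))
  -- the key pointwise estimate at height `h`: polynomial prefactor `e^{16x}` against `e^{-c x²}`
  have key : ∀ h : ℕ, ∀ A : ℝ, A ≤ 16 →
      Real.exp (A * Real.log (Real.sqrt (γ * ((L : ℝ)⁻¹) ^ h))⁻¹) *
          Real.exp (-(c * Real.log (Real.sqrt (γ * ((L : ℝ)⁻¹) ^ h))⁻¹ ^ 2)) ≤ γ * ((L : ℝ)⁻¹) ^ h := by
    intro h A hA
    obtain ⟨hg, hg1, hg2, _⟩ := coupling_basic hL1 hγ hγ1 h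
    have hx := log_inv_coupling_ge hL1 hγ hγ1 hγX h
    set x := Real.log (Real.sqrt (γ * ((L : ℝ)⁻¹) ^ h))⁻¹ with hxdef
    have hx0 : 0 ≤ x := hX0.trans hx
    -- `c x² ≥ 18 x` since `x ≥ 18/c + 1`
    have hquad : 18 * x ≤ c * x ^ 2 := by
      have h1 : 18 ≤ c * X := by
        rw [hX, mul_add, mul_div_cancel₀ _ hcpos.ne']
        linarith [hcpos]
      have h2 : c * X ≤ c * x := mul_le_mul_of_nonneg_left hx hcpos.le
      nlinarith
    rw [← Real.exp_add, ← hg2, B10.sq_eq_exp_log _ hg, ← hxdef]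
    exact Real.exp_le_exp.mpr (by nlinarith)
  -- `p(g_h)² ≥ b₀² x_h²`, hence `e^{-c₀ p²} ≤ e^{-c x²}` (finest level)
  have hrate : ∀ h : ℕ,
      Real.exp (-(c₀ * B10.pFun b₀ p₀ (Real.sqrt (γ * ((L : ℝ)⁻¹) ^ h)) ^ 2)) ≤
        Real.exp (-(c * Real.log (Real.sqrt (γ * ((L : ℝ)⁻¹) ^ h))⁻¹ ^ 2)) := by
    intro h
    obtain ⟨hg, hg1, _, _⟩ := coupling_basic hL1 hγ hγ1 h
    have hp := sq_log_le_pFun_sq (b₀ := b₀) hp₀ hg hg1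
    refine Real.exp_le_exp.mpr (neg_le_neg ?_)
    calc c * Real.log (Real.sqrt (γ * ((L : ℝ)⁻¹) ^ h))⁻¹ ^ 2
        = c₀ * (b₀ ^ 2 * Real.log (Real.sqrt (γ * ((L : ℝ)⁻¹) ^ h))⁻¹ ^ 2) := by rw [hc]; ring
      _ ≤ c₀ * B10.pFun b₀ p₀ (Real.sqrt (γ * ((L : ℝ)⁻¹) ^ h)) ^ 2 := mul_le_mul_of_nonneg_left hp hc₀.le
  -- `p(g_h) ≥ b₀ x_h`, hence `e^{6x} e^{-c₁ p} ≤ e^{-2x} = γL^{-h}` (averaged levels; `c₁ b₀ ≥ 8`)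
  have hlin : ∀ h : ℕ,
      Real.exp (6 * Real.log (Real.sqrt (γ * ((L : ℝ)⁻¹) ^ h))⁻¹) *
          Real.exp (-(c₁ * B10.pFun b₀ p₀ (Real.sqrt (γ * ((L : ℝ)⁻¹) ^ h)))) ≤ γ * ((L : ℝ)⁻¹) ^ h := by
    intro h
    obtain ⟨hg, hg1, hg2, _⟩ := coupling_basic hL1 hγ hγ1 h
    set x := Real.log (Real.sqrt (γ * ((L : ℝ)⁻¹) ^ h))⁻¹ with hxdef
    have hx0 : 0 ≤ x := B10.log_inv_nonneg_of_le_one hg hg1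
    have hp : b₀ * x ≤ B10.pFun b₀ p₀ (Real.sqrt (γ * ((L : ℝ)⁻¹) ^ h)) := by
      have h1 : 1 + x ≤ (1 + x) ^ p₀ := by
        have := Real.rpow_le_rpow_of_exponent_le (by linarith : (1 : ℝ) ≤ 1 + x) hp₀
        rwa [Real.rpow_one] at this
      unfold B10.pFun
      rw [← hxdef]
      exact mul_le_mul_of_nonneg_left (by linarith) hb₀.le
    have hinv : γ * ((L : ℝ)⁻¹) ^ h = Real.exp (-(2 * x)) := by
      have := inv_coupling_sq_eq_exp hL1 hγ hγ1 h
      rw [← hxdef] at this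
      rw [Real.exp_neg, ← this, inv_inv]
    have h8 : 8 * x ≤ c₁ * B10.pFun b₀ p₀ (Real.sqrt (γ * ((L : ℝ)⁻¹) ^ h)) :=
      calc 8 * x ≤ c₁ * b₀ * x := mul_le_mul_of_nonneg_right hcb hx0
        _ = c₁ * (b₀ * x) := by ring
        _ ≤ c₁ * B10.pFun b₀ p₀ (Real.sqrt (γ * ((L : ℝ)⁻¹) ^ h)) := mul_le_mul_of_nonneg_left hp hc₁.le
    rw [← Real.exp_add]
    calc Real.exp (6 * x + -(c₁ * B10.pFun b₀ p₀ (Real.sqrt (γ * ((L : ℝ)⁻¹) ^ h))))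
        ≤ Real.exp (-(2 * x)) := Real.exp_le_exp.mpr (by linarith)
      _ = γ * ((L : ℝ)⁻¹) ^ h := hinv.symm
  -- level-0 term `≤ V C₀ γ`
  have hT0 : V * ((L : ℝ) ^ j) ^ 3 * (C₀ * ((γ * ((L : ℝ)⁻¹) ^ K)⁻¹) ^ 5 *
      Real.exp (-(c₀ * B10.pFun b₀ p₀ (Real.sqrt (γ * ((L : ℝ)⁻¹) ^ K)) ^ 2))) ≤ V * C₀ * γ := by
    set x := Real.log (Real.sqrt (γ * ((L : ℝ)⁻¹) ^ K))⁻¹ with hxdef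
    have hLj : ((L : ℝ) ^ j) ^ 3 ≤ ((L : ℝ) ^ K) ^ 3 :=
      pow_le_pow_left₀ (by positivity) (pow_le_pow_right₀ hL' hjK) 3
    have hLK : ((L : ℝ) ^ K) ^ 3 ≤ Real.exp (6 * x) := pow_cube_le_exp hL1 hγ hγ1 K
    have hβ : ((γ * ((L : ℝ)⁻¹) ^ K)⁻¹) ^ 5 = Real.exp (10 * x) := by
      rw [inv_coupling_sq_eq_exp hL1 hγ hγ1 K, ← hxdef, ← Real.exp_nat_mul]; ring_nf
    have hE := hrate K
    have hk := key K 16 le_rfl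
    have hLK' : γ * ((L : ℝ)⁻¹) ^ K ≤ γ := (coupling_basic hL1 hγ hγ1 K).2.2.2
    have hL3 : ((L : ℝ) ^ j) ^ 3 ≤ Real.exp (6 * x) := hLj.trans hLK
    calc V * ((L : ℝ) ^ j) ^ 3 * (C₀ * ((γ * ((L : ℝ)⁻¹) ^ K)⁻¹) ^ 5 *
          Real.exp (-(c₀ * B10.pFun b₀ p₀ (Real.sqrt (γ * ((L : ℝ)⁻¹) ^ K)) ^ 2)))
        ≤ V * Real.exp (6 * x) * (C₀ * Real.exp (10 * x) * Real.exp (-(c * x ^ 2))) := by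
          rw [hβ]
          gcongr
      _ = V * C₀ * (Real.exp (16 * x) * Real.exp (-(c * x ^ 2))) := by
          have : Real.exp (16 * x) = Real.exp (6 * x) * Real.exp (10 * x) := by rw [← Real.exp_add]; ring_nf
          rw [this]; ring
      _ ≤ V * C₀ * (γ * ((L : ℝ)⁻¹) ^ K) := by gcongr
      _ ≤ V * C₀ * γ := by gcongr
  -- level-`i` terms `≤ V Cc γ L^{-(K-i)}`
  have hTi : ∀ i ∈ Finset.Ico 1 j, V * ((L : ℝ) ^ (j - i)) ^ 3 *
      (Cc * Real.exp (-(c₁ * B10.pFun b₀ p₀ (Real.sqrt (γ * ((L : ℝ)⁻¹) ^ (K - i)))))) ≤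
        V * Cc * (γ * ((L : ℝ)⁻¹) ^ (K - i)) := by
    intro i hi
    rw [Finset.mem_Ico] at hi
    set x := Real.log (Real.sqrt (γ * ((L : ℝ)⁻¹) ^ (K - i)))⁻¹ with hxdef
    have hLj : ((L : ℝ) ^ (j - i)) ^ 3 ≤ ((L : ℝ) ^ (K - i)) ^ 3 :=
      pow_le_pow_left₀ (by positivity) (pow_le_pow_right₀ hL' (by omega)) 3
    have hLK : ((L : ℝ) ^ (K - i)) ^ 3 ≤ Real.exp (6 * x) := pow_cube_le_exp hL1 hγ hγ1 (K - i)
    have hk := hlin (K - i)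
    have hL3 : ((L : ℝ) ^ (j - i)) ^ 3 ≤ Real.exp (6 * x) := hLj.trans hLK
    calc V * ((L : ℝ) ^ (j - i)) ^ 3 * (Cc * Real.exp (-(c₁ * B10.pFun b₀ p₀ (Real.sqrt (γ * ((L : ℝ)⁻¹) ^ (K - i))))))
        ≤ V * Real.exp (6 * x) * (Cc * Real.exp (-(c₁ * B10.pFun b₀ p₀ (Real.sqrt (γ * ((L : ℝ)⁻¹) ^ (K - i)))))) := by
          gcongr
      _ = V * Cc * (Real.exp (6 * x) * Real.exp (-(c₁ * B10.pFun b₀ p₀ (Real.sqrt (γ * ((L : ℝ)⁻¹) ^ (K - i)))))) := by ring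
      _ ≤ V * Cc * (γ * ((L : ℝ)⁻¹) ^ (K - i)) := by gcongr
  -- sum up
  have hsum : ∑ i ∈ Finset.Ico 1 j, V * ((L : ℝ) ^ (j - i)) ^ 3 *
      (Cc * Real.exp (-(c₁ * B10.pFun b₀ p₀ (Real.sqrt (γ * ((L : ℝ)⁻¹) ^ (K - i)))))) ≤ V * Cc * γ := by
    calc ∑ i ∈ Finset.Ico 1 j, V * ((L : ℝ) ^ (j - i)) ^ 3 *
          (Cc * Real.exp (-(c₁ * B10.pFun b₀ p₀ (Real.sqrt (γ * ((L : ℝ)⁻¹) ^ (K - i))))))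
        ≤ ∑ i ∈ Finset.Ico 1 j, V * Cc * (γ * ((L : ℝ)⁻¹) ^ (K - i)) := Finset.sum_le_sum hTi
      _ = V * Cc * γ * ∑ i ∈ Finset.Ico 1 j, ((L : ℝ)⁻¹) ^ (K - i) := by rw [Finset.mul_sum]; ring_nf
      _ ≤ V * Cc * γ * 1 := by gcongr; exact sum_Ico_inv_pow_le_one hL hjK
      _ = V * Cc * γ := mul_one _
  -- conclude
  have hfin : V * C₀ * γ + V * Cc * γ ≤ 1 / 4 := by
    have h1 : V * C₀ * γ + V * Cc * γ = V * (C₀ + Cc) * γ := by ring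
    rw [h1]
    have h2 : V * (C₀ + Cc) ≤ D := by rw [hD]; linarith
    have h3 : V * (C₀ + Cc) * γ ≤ D * γ := mul_le_mul_of_nonneg_right h2 hγ.le
    have h4 : D * γ ≤ D * (1 / (4 * D)) := mul_le_mul_of_nonneg_left hγD hD0.le
    have h5 : D * (1 / (4 * D)) = 1 / 4 := by field_simp
    linarith
  linarith [hT0, hsum]

end Summit.QuantumFields.YangMills.Theorems.PoincareLipschitzLinear
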